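import Mathlib
import Summits.Ventures.PercRepro2.RowC1AvoidRepel

/-!
# The four `b`-avoiding BHK signs of row 2′C1, collected (blind cell PercRepro2, p2 g29;
proofs/P2-G29-E1.md §2)

With `Q = {a₁ ↮ a₂}`, `K = C_{G−b}(a₂)`, `K₁ = C_{G−b}(a₁)` (the clusters of the configuration with every
edge at `b` closed; `o ∈ K` = `avoidConnEvent ends b a₂ o`, `o ∈ K₁` = `avoidConnEvent ends b a₁ o`),
for distinct `a₁, a₂, b`:

* `bH_avoidK_attract` (RowC1AvoidAttract): `Cov_μ(1[b ∈ C₂], 1[o ∈ K]) ≥ 0`;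
* `bL_avoidK1_attract` (RowC1AvoidAttract): `Cov_μ(1[b ∈ C₁], 1[o ∈ K₁]) ≥ 0`;
* `bH_avoidK1_repel` (RowC1AvoidRepel): `Cov_μ(1[b ∈ C₂], 1[o ∈ K₁]) ≤ 0`;
* **`bL_avoidK_repel`** (here, the mirror): `Cov_μ(1[b ∈ C₁], 1[o ∈ K]) ≤ 0`,

all cleared by `P(Q)²`.  The sharpening (E1′) of the row (`RowC1.E1Avoid`) is the quantitative
combination `−Cov_μ(1[b ∈ C₂], 1[o ∈ K₁]) ≤ μ(b ∈ C₁, o ∈ K₁) + Cov_μ(1[b ∈ C₂], 1[o ∈ K])`, which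
`e1avoid_iff_cov` below states in cleared form; it remains a CONJECTURE.
-/

namespace Summit.Ventures.PercRepro2

namespace RowC1

section Signs

variable {V : Type*} {E : Type*} [Fintype E] [DecidableEq E] [Fintype V] [DecidableEq V]
  {R : Type*} [CommRing R] [LinearOrder R] [IsStrictOrderedRing R]

/-- **The mirror repulsion** (`bH_avoidK1_repel` with the roots exchanged): for `a₂ ≠ b`,
`P(Q, b ∈ C₁, o ∈ K) · P(Q) ≤ P(Q, b ∈ C₁) · P(Q, o ∈ K)`, `o ∈ K` = `o` joined to `a₂` avoiding `b`. -/
theorem bL_avoidK_repel (p : E → R) (hp : IsProbVec p) (ends : E → Sym2 V) (a₁ a₂ o b : V)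
    (hne : a₂ ≠ b) :
    prob p (connEvent ends a₁ b ∩ avoidConnEvent ends b a₂ o ∩ (connEvent ends a₁ a₂)ᶜ) *
        prob p (connEvent ends a₁ a₂)ᶜ ≤
      prob p (connEvent ends a₁ b ∩ (connEvent ends a₁ a₂)ᶜ) *
        prob p (avoidConnEvent ends b a₂ o ∩ (connEvent ends a₁ a₂)ᶜ) := by
  have h := bH_avoidK1_repel p hp ends a₂ a₁ o b hne
  rwa [connEvent_comm ends a₂ a₁] at h

omit [Fintype V] [DecidableEq V] in
/-- **(E1′) in covariance form**: `E1Avoid` is equivalent to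
`P(Q, b ∈ C₂) · P(Q, o ∈ K₁) − P(Q) · P(Q, b ∈ C₂, o ∈ K₁) ≤ P(Q) · P(Q, b ∈ C₁, o ∈ K₁) +
(P(Q) · P(Q, b ∈ C₂, o ∈ K) − P(Q, b ∈ C₂) · P(Q, o ∈ K))` (the repulsion on the `K₁` side is at most
the `b ∈ C₁` compensation plus the attraction on the `K` side). -/
theorem e1avoid_iff_cov (p : E → R) (ends : E → Sym2 V) (a₁ a₂ o b : V) :
    E1Avoid p ends a₁ a₂ o b ↔
      prob p (connEvent ends a₂ b ∩ (connEvent ends a₁ a₂)ᶜ) *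
          prob p (avoidConnEvent ends b a₁ o ∩ (connEvent ends a₁ a₂)ᶜ) -
        prob p (connEvent ends a₁ a₂)ᶜ *
          prob p (connEvent ends a₂ b ∩ avoidConnEvent ends b a₁ o ∩ (connEvent ends a₁ a₂)ᶜ) ≤
      prob p (connEvent ends a₁ a₂)ᶜ *
          prob p (connEvent ends a₁ b ∩ avoidConnEvent ends b a₁ o ∩ (connEvent ends a₁ a₂)ᶜ) +
        (prob p (connEvent ends a₁ a₂)ᶜ *
            prob p (connEvent ends a₂ b ∩ avoidConnEvent ends b a₂ o ∩ (connEvent ends a₁ a₂)ᶜ) -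
          prob p (connEvent ends a₂ b ∩ (connEvent ends a₁ a₂)ᶜ) *
            prob p (avoidConnEvent ends b a₂ o ∩ (connEvent ends a₁ a₂)ᶜ)) := by
  unfold E1Avoid
  -- `{o ∈ U'} ∩ Q` and `{b ∈ C₂} ∩ {o ∈ U'} ∩ Q` split along `o ∈ K₁` / `o ∈ K` (disjoint on `Q`)
  have hdisj : ∀ A : Set (Config E), Disjoint (A ∩ avoidConnEvent ends b a₁ o ∩ (connEvent ends a₁ a₂)ᶜ)
      (A ∩ avoidConnEvent ends b a₂ o ∩ (connEvent ends a₁ a₂)ᶜ) := by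
    intro A
    rw [Set.disjoint_left]
    rintro ω ⟨⟨-, h1⟩, hQ⟩ ⟨⟨-, h2⟩, -⟩
    exact hQ (conn_trans (conn_of_avoidConn h1) (conn_symm (conn_of_avoidConn h2)))
  have e1 : prob p ((avoidConnEvent ends b a₁ o ∪ avoidConnEvent ends b a₂ o) ∩
      (connEvent ends a₁ a₂)ᶜ) =
      prob p (avoidConnEvent ends b a₁ o ∩ (connEvent ends a₁ a₂)ᶜ) +
        prob p (avoidConnEvent ends b a₂ o ∩ (connEvent ends a₁ a₂)ᶜ) := by
    rw [Set.union_inter_distrib_right, ← prob_union_of_disjoint p]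
    have := hdisj Set.univ
    simpa only [Set.univ_inter] using this
  have e2 : prob p (connEvent ends a₂ b ∩ (avoidConnEvent ends b a₁ o ∪ avoidConnEvent ends b a₂ o) ∩
      (connEvent ends a₁ a₂)ᶜ) =
      prob p (connEvent ends a₂ b ∩ avoidConnEvent ends b a₁ o ∩ (connEvent ends a₁ a₂)ᶜ) +
        prob p (connEvent ends a₂ b ∩ avoidConnEvent ends b a₂ o ∩ (connEvent ends a₁ a₂)ᶜ) := by
    rw [Set.inter_union_distrib_left, Set.union_inter_distrib_right,
      ← prob_union_of_disjoint p (hdisj _)]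
  rw [e1, e2]
  constructor <;> intro h <;> linarith [h]

end Signs

end RowC1

end Summit.Ventures.PercRepro2
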